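import Mathlib
import HarnessLib
import Summits.Ventures.LatticeQCDFlow.Exactness.IMHColdStartConfidence
import Summits.Ventures.LatticeQCDFlow.Scaling.AutoregressiveGaugeAllClosingColdExact

/-!
# LatticeQCDFlow / Scaling — the cold-started exact all-closing conditioner: Gaussian tails and a certified finite-`N` confidence interval for the cold-started run with the exact constant `A`, `A = Z/∏_ℓ c_{#C_ℓ}`

HONEST FRAMING: exact (Metropolis-corrected) sampling algorithms for lattice gauge theory;
figures of merit are autocorrelation/cost numbers at stated couplings and volumes; no
continuum-physics claim.

Venture `LatticeQCDFlow` (cell pub-lqcd), topic `Scaling`, FANOUT row 30 (lean-1, GEN-33) — OUR WORK, the gauge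
instance of this generation's abstract `Exactness/` files.  Setting: `L ≥ 2`; `w` a continuous class-function weight with `0 < m ≤ w ≤ M`,
`w(g⁻¹) = w(g)`; `(T, C)` an all-closing structure (every plaquette closed by exactly one tree link); target
`π = (F/Z)·Haar^{⊗E}`, proposal `q` = the exact autoregression closing all plaquettes of `C_ℓ` at link `ℓ`, exact sampler
`K = indepMH q (Z/∏N)`, cold configuration `U ≡ 1` = the mode of the importance weight, `A = Z/∏_ℓ c_{#C_ℓ}` its acceptance
mass (GEN-28 `allClosing_cold_acceptMass_eq`); `r = 1 − A`; path space = Mathlib `Kernel.trajMeasure`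
(`P_cold` from the cold configuration, `P_π` the equilibrium run).

The abstract file `Exactness/IMHColdStartConfidence` (this generation) instantiated the Scoring row's any-start Hoeffding inequality for
Doeblin chains with flow-MCMC's EXACT Doeblin constant `A` (`K(U, ·) ≥ A·π`).  For the cold-started exact all-closing conditioner (`f` bounded
measurable, `|f| ≤ Cf`, `C' = Cf + |π f|`, `A_N` the mean of the first `N` configurations, `N ≥ 1`, `N s ≥ 4C'/A`):

* **`allClosing_coldStart_abs_tail_le_exp`** — GAUSSIAN TAILS: `P_cold(|A_N − π f| ≥ s) ≤ 2·exp(−(N s − 4C'/A)² / (8 N C'²/A²))`;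
* **`allClosing_coldStart_confidence`** — THE CERTIFIED FINITE-`N` CONFIDENCE STATEMENT: `P_cold(|A_N − π f| < s) ≥ 1 − 2·exp(−(N s − 4C'/A)²/(8 N C'²/A²))`
  — no stationarity, no variance estimate, no `τ_int`: `N` cold-started configurations locate `π f` within `±s` with that confidence.

NOT CLAIMED: sharpness of the constants (GEN-32's exact second moments are sharper at the `1/√N` scale); unbounded observables.

The `Fact` instance is the measurability of the kernel weight (discharged by the measurability clause of GEN-28's
acceptance-mass theorem).  No `def`, no `sorry`, nothing cited as a fact beyond the tree.
-/

noncomputable section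

namespace Summit.Ventures.LatticeQCDFlow.Theory2.Autoregressive

open MeasureTheory ProbabilityTheory Function Finset
open scoped ENNReal
open Literature.MathematicalPhysics.QuantumFieldTheory Literature.MathematicalPhysics.QuantumLattice
open Summit.Ventures.LatticeQCDFlow.Exactness Summit.Ventures.LatticeQCDFlow.Scoring

variable {d L : ℕ} [NeZero L] {G : Type*} [Group G] [TopologicalSpace G] [IsTopologicalGroup G]
  [CompactSpace G] [SecondCountableTopology G] [MeasurableSpace G] [BorelSpace G]
/-- **GAUSSIAN TAILS FOR THE COLD-STARTED RUN**: `P_cold(|A_N − π f| ≥ s) ≤ 2·exp(−(N s − 4C'/A)²/(8 N C'²/A²))` (exact all-closing conditioner). [ours] -/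
theorem allClosing_coldStart_abs_tail_le_exp [MeasurableSingletonClass G] (hL : 2 ≤ L) {w : G → ℝ} (hw : Continuous w) {m M : ℝ} (hm0 : 0 < m)
    (hm : ∀ g, m ≤ w g) (hM : ∀ g, w g ≤ M) (hwinv : ∀ g, w g⁻¹ = w g)
    (T : Finset (Edge d L)) (C : Edge d L → Finset (Plaquette d L))
    (hCne : ∀ ℓ ∈ T, (C ℓ).Nonempty)
    (hCe : ∀ ℓ ∈ T, ∀ p ∈ C ℓ, ℓ ∈ ({(p.1, p.2.1.1), (p.1.shift p.2.1.1, p.2.1.2),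
        (p.1.shift p.2.1.2, p.2.1.1), (p.1, p.2.1.2)} : Finset (Edge d L)))
    (hdisj : ∀ ℓ ∈ T, ∀ ℓ' ∈ T, ℓ ≠ ℓ' → Disjoint (C ℓ) (C ℓ'))
    (hcover : ∀ p : Plaquette d L, ∃ ℓ ∈ T, p ∈ C ℓ)
    (π q : Measure (GaugeConfig d L G)) [IsProbabilityMeasure π] [IsProbabilityMeasure q]
    (hπ : π = (Measure.pi fun _ : Edge d L => haarProbability G).withDensity fun U =>
      ENNReal.ofReal ((∏ p : Plaquette d L, w (plaquetteHolonomy U p.1 p.2.1.1 p.2.1.2)) /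
        ∫ V, ∏ p : Plaquette d L, w (plaquetteHolonomy V p.1 p.2.1.1 p.2.1.2) ∂(Measure.pi fun _ : Edge d L => haarProbability G)))
    (hq : q = (Measure.pi fun _ : Edge d L => haarProbability G).withDensity fun U =>
      ENNReal.ofReal (∏ ℓ ∈ T, (∏ p ∈ C ℓ, w (plaquetteHolonomy U p.1 p.2.1.1 p.2.1.2)) /
          (∫ v, ∏ p ∈ C ℓ, w (plaquetteHolonomy (update U ℓ v) p.1 p.2.1.1 p.2.1.2) ∂(haarProbability G))))
    [Fact (Measurable (fun U =>
        (((∫ V, ∏ p : Plaquette d L, w (plaquetteHolonomy V p.1 p.2.1.1 p.2.1.2) ∂(Measure.pi fun _ : Edge d L => haarProbability G)) /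
          ∏ ℓ ∈ T, (∫ v, ∏ p ∈ C ℓ, w (plaquetteHolonomy (update U ℓ v) p.1 p.2.1.1 p.2.1.2) ∂(haarProbability G))))⁻¹))]
    {f : GaugeConfig d L G → ℝ} (hf : Measurable f) {Cf : ℝ} (hCf : ∀ U, |f U| ≤ Cf) {N : ℕ} (hN : N ≠ 0) {s : ℝ}
    (hs : 4 * (Cf + |∫ V', f V' ∂π|) * ((∫ V, ∏ p : Plaquette d L, w (plaquetteHolonomy V p.1 p.2.1.1 p.2.1.2) ∂(Measure.pi fun _ : Edge d L => haarProbability G)) /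
        ∏ ℓ ∈ T, ∫ h, w h ^ (C ℓ).card ∂(haarProbability G))⁻¹ ≤ N * s) :
    (Kernel.trajMeasure (X := fun _ : ℕ => GaugeConfig d L G) (Measure.dirac (fun _ : Edge d L => (1 : G)))
        (fun n : ℕ => (indepMH q (fun U =>
        (((∫ V, ∏ p : Plaquette d L, w (plaquetteHolonomy V p.1 p.2.1.1 p.2.1.2) ∂(Measure.pi fun _ : Edge d L => haarProbability G)) /
          ∏ ℓ ∈ T, (∫ v, ∏ p ∈ C ℓ, w (plaquetteHolonomy (update U ℓ v) p.1 p.2.1.1 p.2.1.2) ∂(haarProbability G))))⁻¹)).comap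
          (fun h : (i : ↥(Finset.Iic n)) → GaugeConfig d L G => h ⟨n, Finset.mem_Iic.2 le_rfl⟩)
          (measurable_pi_apply _))).real
        {x | s ≤ |(∑ i ∈ Finset.range N, f (x i)) / N - ∫ V', f V' ∂π|} ≤
      2 * Real.exp (-(N * s - 4 * (Cf + |∫ V', f V' ∂π|) * ((∫ V, ∏ p : Plaquette d L, w (plaquetteHolonomy V p.1 p.2.1.1 p.2.1.2) ∂(Measure.pi fun _ : Edge d L => haarProbability G)) /
        ∏ ℓ ∈ T, ∫ h, w h ^ (C ℓ).card ∂(haarProbability G))⁻¹) ^ 2 /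
        (8 * N * (Cf + |∫ V', f V' ∂π|) ^ 2 * ((∫ V, ∏ p : Plaquette d L, w (plaquetteHolonomy V p.1 p.2.1.1 p.2.1.2) ∂(Measure.pi fun _ : Edge d L => haarProbability G)) /
        ∏ ℓ ∈ T, ∫ h, w h ^ (C ℓ).card ∂(haarProbability G))⁻¹ ^ 2)) := by
  obtain ⟨hA, hρq, hmax, hρm, hρpos⟩ := allClosing_cold_acceptMass_eq hL hw hm0 hm hM hwinv T C hCne hCe hdisj hcover π q hπ hq
  set cold : GaugeConfig d L G := fun _ => (1 : G) with hcold
  set ρ : GaugeConfig d L G → ℝ := fun U =>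
    (∫ V, ∏ p : Plaquette d L, w (plaquetteHolonomy V p.1 p.2.1.1 p.2.1.2) ∂(Measure.pi fun _ : Edge d L => haarProbability G)) /
      ∏ ℓ ∈ T, (∫ v, ∏ p ∈ C ℓ, w (plaquetteHolonomy (update U ℓ v) p.1 p.2.1.1 p.2.1.2) ∂(haarProbability G)) with hρ
  have hw0' : ∀ U, 0 < (ρ U)⁻¹ := fun U => inv_pos.2 (hρpos U)
  have hπ' : (q.withDensity fun U => ENNReal.ofReal (ρ U)⁻¹) = π := withDensity_inv_density hρm hρpos hρq
  haveI : IsProbabilityMeasure (q.withDensity fun U => ENNReal.ofReal (ρ U)⁻¹) := by rw [hπ']; infer_instance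
  have hone : ∫⁻ y, ENNReal.ofReal (ρ y)⁻¹ ∂q = ENNReal.ofReal 1 := by
    have h : π Set.univ = 1 := measure_univ
    rw [← hπ', withDensity_apply _ MeasurableSet.univ, Measure.restrict_univ] at h
    rw [h, ENNReal.ofReal_one]
  have hA' := imhAcceptMass_toReal_eq_of_forall_le (q := q) hw0' cold hmax zero_le_one hone
  have hrate : ((ρ cold)⁻¹)⁻¹ = (∫ V, ∏ p : Plaquette d L, w (plaquetteHolonomy V p.1 p.2.1.1 p.2.1.2) ∂(Measure.pi fun _ : Edge d L => haarProbability G)) /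
        ∏ ℓ ∈ T, ∫ h, w h ^ (C ℓ).card ∂(haarProbability G) := by
    rw [← hA, hA', one_div]
  have hrate' : (ρ cold)⁻¹ = ((∫ V, ∏ p : Plaquette d L, w (plaquetteHolonomy V p.1 p.2.1.1 p.2.1.2) ∂(Measure.pi fun _ : Edge d L => haarProbability G)) /
        ∏ ℓ ∈ T, ∫ h, w h ^ (C ℓ).card ∂(haarProbability G))⁻¹ := by
    rw [← hrate, inv_inv]
  have hs' : 4 * (Cf + |∫ U, f U ∂(q.withDensity fun U => ENNReal.ofReal (ρ U)⁻¹)|) * (ρ cold)⁻¹ ≤ N * s := by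
    rw [hπ', hrate']; exact hs
  have h := imh_chain_abs_tail_le_exp_mode (q := q) hw0' hmax hf hCf hN hs' (x₀ := cold)
  rw [hπ', hrate'] at h
  exact h

/-- **THE CERTIFIED FINITE-`N` CONFIDENCE STATEMENT**: `P_cold(|A_N − π f| < s) ≥ 1 − 2·exp(−(N s − 4C'/A)²/(8 N C'²/A²))` (exact all-closing conditioner). [ours] -/
theorem allClosing_coldStart_confidence [MeasurableSingletonClass G] (hL : 2 ≤ L) {w : G → ℝ} (hw : Continuous w) {m M : ℝ} (hm0 : 0 < m)
    (hm : ∀ g, m ≤ w g) (hM : ∀ g, w g ≤ M) (hwinv : ∀ g, w g⁻¹ = w g)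
    (T : Finset (Edge d L)) (C : Edge d L → Finset (Plaquette d L))
    (hCne : ∀ ℓ ∈ T, (C ℓ).Nonempty)
    (hCe : ∀ ℓ ∈ T, ∀ p ∈ C ℓ, ℓ ∈ ({(p.1, p.2.1.1), (p.1.shift p.2.1.1, p.2.1.2),
        (p.1.shift p.2.1.2, p.2.1.1), (p.1, p.2.1.2)} : Finset (Edge d L)))
    (hdisj : ∀ ℓ ∈ T, ∀ ℓ' ∈ T, ℓ ≠ ℓ' → Disjoint (C ℓ) (C ℓ'))
    (hcover : ∀ p : Plaquette d L, ∃ ℓ ∈ T, p ∈ C ℓ)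
    (π q : Measure (GaugeConfig d L G)) [IsProbabilityMeasure π] [IsProbabilityMeasure q]
    (hπ : π = (Measure.pi fun _ : Edge d L => haarProbability G).withDensity fun U =>
      ENNReal.ofReal ((∏ p : Plaquette d L, w (plaquetteHolonomy U p.1 p.2.1.1 p.2.1.2)) /
        ∫ V, ∏ p : Plaquette d L, w (plaquetteHolonomy V p.1 p.2.1.1 p.2.1.2) ∂(Measure.pi fun _ : Edge d L => haarProbability G)))
    (hq : q = (Measure.pi fun _ : Edge d L => haarProbability G).withDensity fun U =>
      ENNReal.ofReal (∏ ℓ ∈ T, (∏ p ∈ C ℓ, w (plaquetteHolonomy U p.1 p.2.1.1 p.2.1.2)) /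
          (∫ v, ∏ p ∈ C ℓ, w (plaquetteHolonomy (update U ℓ v) p.1 p.2.1.1 p.2.1.2) ∂(haarProbability G))))
    [Fact (Measurable (fun U =>
        (((∫ V, ∏ p : Plaquette d L, w (plaquetteHolonomy V p.1 p.2.1.1 p.2.1.2) ∂(Measure.pi fun _ : Edge d L => haarProbability G)) /
          ∏ ℓ ∈ T, (∫ v, ∏ p ∈ C ℓ, w (plaquetteHolonomy (update U ℓ v) p.1 p.2.1.1 p.2.1.2) ∂(haarProbability G))))⁻¹))]
    {f : GaugeConfig d L G → ℝ} (hf : Measurable f) {Cf : ℝ} (hCf : ∀ U, |f U| ≤ Cf) {N : ℕ} (hN : N ≠ 0) {s : ℝ}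
    (hs : 4 * (Cf + |∫ V', f V' ∂π|) * ((∫ V, ∏ p : Plaquette d L, w (plaquetteHolonomy V p.1 p.2.1.1 p.2.1.2) ∂(Measure.pi fun _ : Edge d L => haarProbability G)) /
        ∏ ℓ ∈ T, ∫ h, w h ^ (C ℓ).card ∂(haarProbability G))⁻¹ ≤ N * s) :
    1 - 2 * Real.exp (-(N * s - 4 * (Cf + |∫ V', f V' ∂π|) * ((∫ V, ∏ p : Plaquette d L, w (plaquetteHolonomy V p.1 p.2.1.1 p.2.1.2) ∂(Measure.pi fun _ : Edge d L => haarProbability G)) /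
        ∏ ℓ ∈ T, ∫ h, w h ^ (C ℓ).card ∂(haarProbability G))⁻¹) ^ 2 /
        (8 * N * (Cf + |∫ V', f V' ∂π|) ^ 2 * ((∫ V, ∏ p : Plaquette d L, w (plaquetteHolonomy V p.1 p.2.1.1 p.2.1.2) ∂(Measure.pi fun _ : Edge d L => haarProbability G)) /
        ∏ ℓ ∈ T, ∫ h, w h ^ (C ℓ).card ∂(haarProbability G))⁻¹ ^ 2)) ≤
      (Kernel.trajMeasure (X := fun _ : ℕ => GaugeConfig d L G) (Measure.dirac (fun _ : Edge d L => (1 : G)))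
        (fun n : ℕ => (indepMH q (fun U =>
        (((∫ V, ∏ p : Plaquette d L, w (plaquetteHolonomy V p.1 p.2.1.1 p.2.1.2) ∂(Measure.pi fun _ : Edge d L => haarProbability G)) /
          ∏ ℓ ∈ T, (∫ v, ∏ p ∈ C ℓ, w (plaquetteHolonomy (update U ℓ v) p.1 p.2.1.1 p.2.1.2) ∂(haarProbability G))))⁻¹)).comap
          (fun h : (i : ↥(Finset.Iic n)) → GaugeConfig d L G => h ⟨n, Finset.mem_Iic.2 le_rfl⟩)
          (measurable_pi_apply _))).real
        {x | |(∑ i ∈ Finset.range N, f (x i)) / N - ∫ V', f V' ∂π| < s} := by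
  obtain ⟨hA, hρq, hmax, hρm, hρpos⟩ := allClosing_cold_acceptMass_eq hL hw hm0 hm hM hwinv T C hCne hCe hdisj hcover π q hπ hq
  set cold : GaugeConfig d L G := fun _ => (1 : G) with hcold
  set ρ : GaugeConfig d L G → ℝ := fun U =>
    (∫ V, ∏ p : Plaquette d L, w (plaquetteHolonomy V p.1 p.2.1.1 p.2.1.2) ∂(Measure.pi fun _ : Edge d L => haarProbability G)) /
      ∏ ℓ ∈ T, (∫ v, ∏ p ∈ C ℓ, w (plaquetteHolonomy (update U ℓ v) p.1 p.2.1.1 p.2.1.2) ∂(haarProbability G)) with hρ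
  have hw0' : ∀ U, 0 < (ρ U)⁻¹ := fun U => inv_pos.2 (hρpos U)
  have hπ' : (q.withDensity fun U => ENNReal.ofReal (ρ U)⁻¹) = π := withDensity_inv_density hρm hρpos hρq
  haveI : IsProbabilityMeasure (q.withDensity fun U => ENNReal.ofReal (ρ U)⁻¹) := by rw [hπ']; infer_instance
  have hone : ∫⁻ y, ENNReal.ofReal (ρ y)⁻¹ ∂q = ENNReal.ofReal 1 := by
    have h : π Set.univ = 1 := measure_univ
    rw [← hπ', withDensity_apply _ MeasurableSet.univ, Measure.restrict_univ] at h
    rw [h, ENNReal.ofReal_one]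
  have hA' := imhAcceptMass_toReal_eq_of_forall_le (q := q) hw0' cold hmax zero_le_one hone
  have hrate : ((ρ cold)⁻¹)⁻¹ = (∫ V, ∏ p : Plaquette d L, w (plaquetteHolonomy V p.1 p.2.1.1 p.2.1.2) ∂(Measure.pi fun _ : Edge d L => haarProbability G)) /
        ∏ ℓ ∈ T, ∫ h, w h ^ (C ℓ).card ∂(haarProbability G) := by
    rw [← hA, hA', one_div]
  have hrate' : (ρ cold)⁻¹ = ((∫ V, ∏ p : Plaquette d L, w (plaquetteHolonomy V p.1 p.2.1.1 p.2.1.2) ∂(Measure.pi fun _ : Edge d L => haarProbability G)) /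
        ∏ ℓ ∈ T, ∫ h, w h ^ (C ℓ).card ∂(haarProbability G))⁻¹ := by
    rw [← hrate, inv_inv]
  have hs' : 4 * (Cf + |∫ U, f U ∂(q.withDensity fun U => ENNReal.ofReal (ρ U)⁻¹)|) * (ρ cold)⁻¹ ≤ N * s := by
    rw [hπ', hrate']; exact hs
  have h := imh_chain_confidence_mode (q := q) hw0' hmax hf hCf hN hs' (x₀ := cold)
  rw [hπ', hrate'] at h
  exact h


end Summit.Ventures.LatticeQCDFlow.Theory2.Autoregressive

end
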